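import Summits.BirchSwinnertonDyer.Rank1Residual.X1.RankOneRegulatorSqueeze
import HarnessLib

/-!
# Route R on X1 ∩ {r = 1}, class form: the rank-one leaf statement from PUBLISHED theorems plus
# per-pair FINITE certificates only (type B: Schneider; type A: a route-R certificate in the class)

HONEST FRAMING (cell `b2b-bsdres`, run/shared/lean/b2b/bsd-rank1-residual/, verbatim in every
file): the goal of the cell is to DELETE the COMBINATION-SHAPED residual classes of the
Birch–Swinnerton-Dyer formula for ALL analytic-rank `≤ 1` elliptic curves over `ℚ` — "full BSD
formula for every rank `≤ 1` curve in class `C`" assembled STRICTLY from published theorems — so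
that the rank-`≤ 1` remainder becomes exactly the CONSTRUCTION-SHAPED classes, which are TYPED
(missing-input `Prop`s), NOT attempted. This is not "finishing BSD". CLASS-OWNERS.md: row
"X1 (r = 1)" — research route; NO CLAIM BEYOND STATED CLASSES; no label change; nothing is booked by
this file; no preprint enters; NO definition, NO named fact.

Unit `b2b-bsdres-x1a` (X1 prover A, gen 16). Third sequel of `X1/RankOneRegulatorSqueeze.lean`
(p263077). WHAT. `X1/RankOne.lean` records two class-level shapes of the rank-one leaf statement
`RankOne.Statement` (= `BSD(E,p)` at every X1 pair with `ord_{s=1} L(E,s) = 1`): route A needs the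
Keller–Yin PREPRINT display (`statement_of_KY_of_schneider_typeB`), route B needs Mazur's main conjecture
at the anomalous type-A pairs — UNSTATED in print (`statement_of_mazurMainConjecture_typeA_of_schneiderOnLeaf`).
Route R gives a third shape with NEITHER: **`Statement` follows from the PUBLISHED facts (Greenberg–Vatsal
2000 (1.3), Wuthrich 2014 Thm. 16, BMS Thm. 1.7, Perrin-Riou 1987, Mazur–Tate `σ`, modularity, GZK,
Cassels) plus, at every leaf pair, a FINITE `p`-adic certificate** — on type B the Schneider certificate
(`[T¹]L_p ≠ 0`, x1b's B1), on type A a route-R certificate `(vc, v)` read on SOME globally minimal curve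
of the `ℚ`-isogeny class (`ord_p [T¹](ϖ·L_p) = vc ≠ 0`, `v ≤ ord_p Reg_p` canonical,
`vc + 1 + 2·ord_p #tors ≤ v + ord_p ∏c_ℓ + 2·ord_p #Ẽ(𝔽_p)`). So the CLASS is certificate-shaped in
certifiable currency: its residue is the set of type-A rank-one pairs whose isogeny class carries NO
route-R certificate — by the TIER theorem (`X1/RankOneRegulatorSqueezeTier.lean`) exactly the pairs
with `p ∣ #Ш(E')_an` at EVERY isogenous `E'` (0 of the 8 882 + 552 + 67 + 17 type-A rank-one census
classes with `N < 5·10⁵`, cc-eng-1 `T-X1R1iso`; x1a gen 16 census: certificate ON FILE at 8 879 +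
552 + 67 + 17 of them, the 3 others instrument-limited). Whether every pair admits the certificate is
(MC ∧ `Ш(E')[p^∞] = 0` for some `E' ∼ E`) — NOT claimed.

References: [GreenbergVatsal2000] Thm. (1.3); [Wuthrich2014] Thm. 16; [BalakrishnanMullerStein2015]
Thm. 1.7; [PerrinRiou1987] §1.4 Cor. 1.8; [MazurSteinTate2006] Thm. 1.3; [MilneADT2006] Thm. I.7.3;
HOME/b2b-bsdres-x1a/X1-CHAIN.md §17b, §25.
-/

noncomputable section

open scoped Classical MatrixGroups ModularForm

open PowerSeries CongruenceSubgroup WeierstrassCurve Literature.NumberTheory.EllipticCurves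
  Literature.NumberTheory.EllipticCurves.ModularForms
  Literature.NumberTheory.EllipticCurves.Wuthrich2014
  Literature.NumberTheory.EllipticCurves.Rank1Residual
  Summit.BirchSwinnertonDyer.BirchSwinnertonDyer.Theorems
  Summit.BirchSwinnertonDyer.BirchSwinnertonDyer.Theorems.Rank1ResidualX1Defs
  Summit.BirchSwinnertonDyer.Rank1Residual.X1.RankOneLeadingTermSqueeze

set_option autoImplicit false

namespace Summit.BirchSwinnertonDyer.Rank1Residual.X1.RankOne

/-- **CLASS X1 ∩ {r = 1} FROM PUBLISHED THEOREMS + PER-PAIR FINITE CERTIFICATES (route R shape).**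
`RankOne.Statement` holds granted: the PUBLISHED named facts Greenberg–Vatsal 2000 Thm. (1.3) (`hGV`,
type B), Wuthrich 2014 Thm. 16 (`hW16`), BMS Thm. 1.7 at odd `p` (`hS`), Perrin-Riou 1987 (`hPR`),
Mazur–Tate `σ` (`hMT`), modularity (`hmod`, `hmod'`), GZK (`hGZK`), Cassels (`hCassels`); and PER PAIR —
(`hB`) on type-B leaf pairs Schneider's non-degeneracy at the canonical datum (certified per pair by
`[T¹]L_p ≠ 0`, `Leaf.schneider_of_coeff_one_ne_zero`); (`hA`) on type-A leaf pairs a route-R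
certificate `(vc, v)` at some globally minimal curve `W'` of the `ℚ`-isogeny class. NO main-conjecture
hypothesis, NO preprint. (Type B: `Leaf.bsdp_of_gvPar_of_schneider`; type A:
`Leaf.bsdp_of_isIsogenous_of_coeffOneVal_of_regulatorGE`.) [cite: GreenbergVatsal2000, Thm. (1.3)]
[cite: Wuthrich2014, Thm. 16 (p. 397)] [cite: BalakrishnanMullerStein2015, Thm. 1.7]
[cite: PerrinRiou1987, §1.4 Cor. 1.8] [cite: MilneADT2006, Thm. I.7.3] -/
theorem statement_of_schneider_typeB_of_regulatorCertificates_typeA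
    (hGV : GreenbergVatsal2000.thm13_charIdeal_eq_of_gvPar)
    (hW16 : Wuthrich2014.charIdeal_dvd_padicLFunction) (hS : Schneider1985_order_charGenerator_odd)
    (hPR : perrinRiou_rankOne_leadingTerms_odd) (hMT : mazur_tate_sigma_exists_odd)
    (hmod : nonempty_modularParametrizationData) (hmod' : hasEntireLFunction_rat)
    (hGZK : rank_eq_analyticRank_of_analyticRank_le_one) (hCassels : bsdRHS_eq_of_isIsogenous)
    (hB : ∀ (W : WeierstrassCurve ℚ) [W.IsElliptic] [W.IsGloballyMinimal] (p : ℕ) [Fact p.Prime],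
      Leaf W p → GVPar W p → ∀ Dh : PAdicHeightData W p, Dh.IsCanonical → SchneiderConjecture Dh)
    (hA : ∀ (W : WeierstrassCurve ℚ) [W.IsElliptic] [W.IsGloballyMinimal] (p : ℕ) [Fact p.Prime],
      Leaf W p → ¬ GVPar W p →
        ∃ (W' : WeierstrassCurve ℚ) (_ : W'.IsElliptic) (_ : W'.IsGloballyMinimal),
          IsIsogenous W W' ∧ ∃ vc v : ℤ, vc ≠ 0 ∧ AnalyticCoeffOneVal W' p vc ∧
            (∀ Dh : PAdicHeightData W' p, Dh.IsCanonical → v ≤ (padicRegulator Dh).valuation) ∧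
            vc + 1 + 2 * padicValNat p W'.torsionOrder ≤
              v + padicValNat p W'.tamagawaProduct + 2 * padicValNat p (W'.reductionPointCount p)) :
    Statement := by
  intro W _ _ p _ hL
  by_cases hpar : GVPar W p
  · exact hL.bsdp_of_gvPar_of_schneider hGV hS hPR hMT hmod hGZK hpar (hB W p hL hpar)
  · obtain ⟨W', _, _, hiso, vc, v, hvc, hc, hv, hb⟩ := hA W p hL hpar
    exact hL.bsdp_of_isIsogenous_of_coeffOneVal_of_regulatorGE hW16 hS hPR hMT hmod hmod' hGZK hCassels
      hiso hvc hc hv hb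

/-- **The same with route-R certificates on BOTH types** (type B needs no Greenberg–Vatsal then: route R
is type-free). `Statement` ⇐ Wuthrich Thm. 16, BMS 1.7, Perrin-Riou 1987, Mazur–Tate `σ`, modularity,
GZK, Cassels + a route-R certificate in the isogeny class of every leaf pair.
[cite: Wuthrich2014, Thm. 16 (p. 397)] [cite: BalakrishnanMullerStein2015, Thm. 1.7]
[cite: PerrinRiou1987, §1.4 Cor. 1.8] [cite: MilneADT2006, Thm. I.7.3] -/
theorem statement_of_regulatorCertificates
    (hW16 : Wuthrich2014.charIdeal_dvd_padicLFunction) (hS : Schneider1985_order_charGenerator_odd)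
    (hPR : perrinRiou_rankOne_leadingTerms_odd) (hMT : mazur_tate_sigma_exists_odd)
    (hmod : nonempty_modularParametrizationData) (hmod' : hasEntireLFunction_rat)
    (hGZK : rank_eq_analyticRank_of_analyticRank_le_one) (hCassels : bsdRHS_eq_of_isIsogenous)
    (hR : ∀ (W : WeierstrassCurve ℚ) [W.IsElliptic] [W.IsGloballyMinimal] (p : ℕ) [Fact p.Prime],
      Leaf W p →
        ∃ (W' : WeierstrassCurve ℚ) (_ : W'.IsElliptic) (_ : W'.IsGloballyMinimal),
          IsIsogenous W W' ∧ ∃ vc v : ℤ, vc ≠ 0 ∧ AnalyticCoeffOneVal W' p vc ∧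
            (∀ Dh : PAdicHeightData W' p, Dh.IsCanonical → v ≤ (padicRegulator Dh).valuation) ∧
            vc + 1 + 2 * padicValNat p W'.torsionOrder ≤
              v + padicValNat p W'.tamagawaProduct + 2 * padicValNat p (W'.reductionPointCount p)) :
    Statement := by
  intro W _ _ p _ hL
  obtain ⟨W', _, _, hiso, vc, v, hvc, hc, hv, hb⟩ := hR W p hL
  exact hL.bsdp_of_isIsogenous_of_coeffOneVal_of_regulatorGE hW16 hS hPR hMT hmod hmod' hGZK hCassels
    hiso hvc hc hv hb

/-- **And Mazur's main conjecture class-wide in the same currency:** at every leaf pair carrying a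
route-R certificate ON THE PAIR ITSELF (`W' = W`), `MazurMainConjecture W p` (no Greenberg–Vatsal, no
parity type). [cite: Wuthrich2014, Thm. 16 (p. 397)] [cite: BalakrishnanMullerStein2015, Thm. 1.7] -/
theorem forall_mazurMainConjecture_of_regulatorCertificates
    (hW16 : Wuthrich2014.charIdeal_dvd_padicLFunction) (hS : Schneider1985_order_charGenerator_odd)
    (hMT : mazur_tate_sigma_exists_odd) (hGZK : rank_eq_analyticRank_of_analyticRank_le_one)
    (hR : ∀ (W : WeierstrassCurve ℚ) [W.IsElliptic] [W.IsGloballyMinimal] (p : ℕ) [Fact p.Prime],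
      Leaf W p → ∃ vc v : ℤ, vc ≠ 0 ∧ AnalyticCoeffOneVal W p vc ∧
        (∀ Dh : PAdicHeightData W p, Dh.IsCanonical → v ≤ (padicRegulator Dh).valuation) ∧
        vc + 1 + 2 * padicValNat p W.torsionOrder ≤
          v + padicValNat p W.tamagawaProduct + 2 * padicValNat p (W.reductionPointCount p)) :
    ∀ (W : WeierstrassCurve ℚ) [W.IsElliptic] [W.IsGloballyMinimal] (p : ℕ) [Fact p.Prime],
      Leaf W p → MazurMainConjecture W p := by
  intro W _ _ p _ hL
  have hX := isClassX1_of_classX1 hL.1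
  obtain ⟨vc, v, hvc, hc, hv, hb⟩ := hR W p hL
  exact RankOneRegulatorSqueeze.mazurMainConjecture_of_coeffOneVal_of_regulatorGE hW16 hS hMT hX.two_ne
    hX.hasGoodReductionAtPrime hX.not_dvd_frobeniusTrace hX.not_hasIrreducibleModPGaloisRep
    (hL.mordellWeilRank_eq_one hGZK) hvc hc hv hb

end Summit.BirchSwinnertonDyer.Rank1Residual.X1.RankOne

end
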